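import Literature.NumberTheory.EllipticCurves.FineSelmerDevissageProofs
import Literature.NumberTheory.EllipticCurves.FineSelmerFiniteOfUnramifiedClassesProofs
import Literature.NumberTheory.GaloisRepresentations.ContinuousH1OrderTwo
import Literature.NumberTheory.GaloisRepresentations.TateH2VanishingArchimedean
import HarnessLib

/-!
# `Sel₀(K_∞, M)` is finite as soon as `Sel₀(F_∞, M|_F)` is, for a finite extension `F/K`
# (restriction along `Γ_F → Γ_K`; proved, no definition, no named fact, no `sorry`)

`Proofs` file (theorems only) in topic `NumberTheory/EllipticCurves` (namespace
`Literature.NumberTheory.EllipticCurves.FineSelmerRestrictionDescent`), written by the prover seat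
`bsd-potss-rkm` g33 (cell `bsd-potss`; item stmt-BirchSwinnertonDyer-19196; `--supports`; closes nothing).
This is Lim 2017 Lemma 3.2 («if `Y_S(T/L^{cyc})` is finitely generated over `R` then so is
`Y_S(T/F^{cyc})`») at the level of the residual fine Selmer group, in the tree's idiom: the map
`z ↦ z ∘ res` on cocycles carries `Sel₀(K_∞, M)`-classes to `Sel₀(F_∞, M|_F)`-classes (`M|_F` = `M` with
`Γ_F` acting through `res = absGaloisRestrict K F`, `F_∞ = F·K_∞`: `ker κ_F = res⁻¹ ker κ`), and a cocycle
on `H = Gal(K̄/K_∞)` is recovered from `z ∘ res` and its values on representatives of the finite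
`H / (H ∩ res Γ_F)`.

* §0 `nsmul_subgroupH1_eq_zero`, `finite_setOf_oneCocycleClass_mem` (cocycles with class in a finite
  set are finite, `M` finite), `isOpen_range_absGaloisRestrict` (`res Γ_F = Gal(K̄/e(F))` is open).
* §1 `finite_unramifiedHoms_of_finite_unramifiedClasses` — the same-field case of the dialect bridge
  (`unramifiedHoms (ker κ) M ∅` finite from the char-form finiteness, trivial action).
* §2 `oneCocycleClass_comp_mem_fineSelmerInfty` (fine classes restrict to fine classes; at the finite
  places via `FineSelmerDevissage.exists_eq_smul_sub_of_mem_fineSelmerInfty` at EVERY prime and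
  `AbsIntegersEquiv.comap_decompositionSubgroup_comap_absIntegersMap`; at the infinite places of `F`
  the local group has order `≤ 2` and `M` has odd exponent), and
  **`finite_fineSelmerInfty_of_finite_fineSelmerInfty_restrict`**.

References: [Lim2017FineSelmer] §3 Lemma 3.2; [CoatesSujatha2005] §3; [SerreGaloisCohomology1997]
I.§2.4 (Cor. of Prop. 9), I.§2.5, I.§5.8; [NeukirchANT1999] Ch. I §9.
-/

set_option autoImplicit false

noncomputable section

open scoped Classical Pointwise

namespace Literature.NumberTheory.EllipticCurves.FineSelmerRestrictionDescent

open NumberField IsDedekindDomain Field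
open Literature.NumberTheory.EllipticCurves Literature.NumberTheory.EllipticCurves.GreenbergSelmer
  Literature.NumberTheory.EllipticCurves.GreenbergVatsal2000
  Literature.NumberTheory.EllipticCurves.FineSelmerTrivialisingRestriction
  Literature.NumberTheory.EllipticCurves.FineSelmerCoefficientMap
  Literature.NumberTheory.EllipticCurves.FineSelmerDevissage
  Literature.NumberTheory.GaloisRepresentations

/-! ## §0 Generic helpers -/

section Helpers

variable {K : Type} [Field K]
variable {M : Type} [AddCommGroup M] [DistribMulAction (absoluteGaloisGroup K) M]
  [TopologicalSpace M] [DiscreteTopology M]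

/-- `H¹(H, M)` is killed by `n` when `M` is. [cite: SerreGaloisCohomology1997, I.§2.2] -/
theorem nsmul_subgroupH1_eq_zero (H : Subgroup (absoluteGaloisGroup K)) {n : ℕ}
    (hM : ∀ m : M, n • m = 0) (y : subgroupH1 H M) : n • y = 0 := by
  obtain ⟨φ, rfl⟩ := oneCocycleClass_surjective _ y
  have h := oneCocycleClass_smul (discreteTopRep H M) (n : ℤ) φ
  have hφ : (n : ℤ) • φ = 0 := by
    apply Subtype.ext
    ext g
    change (n : ℤ) • φ.1 g = 0
    rw [natCast_zsmul, hM]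
  rw [← Nat.cast_smul_eq_nsmul ℤ, ← h, hφ, oneCocycleClass_zero]

/-- **Cocycles whose class lies in a finite set form a finite set** (`M` finite): two cocycles with the
same class differ by one of the finitely many coboundaries `g ↦ g • v − v`.
[cite: SerreGaloisCohomology1997, I.§2.2 (cocycles and coboundaries)] -/
theorem finite_setOf_oneCocycleClass_mem [Finite M] (H : Subgroup (absoluteGaloisGroup K))
    {S : Set (subgroupH1 H M)} (hS : S.Finite) :
    {z : contOneCocycles (discreteTopRep H M) | oneCocycleClass _ z ∈ S}.Finite := by
  have hcover : {z : contOneCocycles (discreteTopRep H M) | oneCocycleClass _ z ∈ S} ⊆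
      ⋃ c ∈ S, {z | oneCocycleClass (discreteTopRep H M) z = c} := by
    intro z hz
    exact Set.mem_biUnion hz rfl
  refine (hS.biUnion fun c _ ↦ ?_).subset hcover
  -- the coercion to functions is injective on cocycles
  have hinj : Set.InjOn (fun z : contOneCocycles (discreteTopRep H M) ↦ (z.1 : H → M))
      {z | oneCocycleClass (discreteTopRep H M) z = c} := fun z _ z' _ h ↦
    Subtype.ext (ContinuousMap.ext fun g ↦ congrFun h g)
  refine Set.Finite.of_finite_image ?_ hinj
  by_cases hc : ∃ z₀ : contOneCocycles (discreteTopRep H M), oneCocycleClass _ z₀ = c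
  · obtain ⟨z₀, rfl⟩ := hc
    -- every `z` with `[z] = [z₀]` is `z₀ + ∂v` as a function
    refine (Set.finite_range fun v : M ↦ fun g : H ↦
      z₀.1 g + ((g : absoluteGaloisGroup K) • v - v)).subset ?_
    rintro _ ⟨z, hz, rfl⟩
    have h0 : oneCocycleClass (discreteTopRep H M) (z - z₀) = 0 := by
      rw [oneCocycleClass_sub, sub_eq_zero]; exact hz
    rw [oneCocycleClass_eq_zero_iff] at h0
    obtain ⟨v, hv⟩ := h0
    refine ⟨v, funext fun g ↦ ?_⟩
    have hg : z.1 g - z₀.1 g = (g : absoluteGaloisGroup K) • v - v := hv g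
    show z₀.1 g + ((g : absoluteGaloisGroup K) • v - v) = z.1 g
    rw [← hg]; abel
  · have : {z : contOneCocycles (discreteTopRep H M) | oneCocycleClass _ z = c} = ∅ := by
      ext z
      simp only [Set.mem_setOf_eq, Set.mem_empty_iff_false, iff_false]
      exact fun h ↦ hc ⟨z, h⟩
    rw [this, Set.image_empty]
    exact Set.finite_empty

end Helpers

/-- **`res Γ_F` is open in `Γ_K`** for a finite extension `F/K`: it is the fixing group of the finite
subextension `e(F) ⊆ K̄` (`exists_mem_range_absGaloisRestrict_iff`). [cite: NeukirchANT1999, Ch. IV §1 (Krull topology)] -/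
theorem isOpen_range_absGaloisRestrict (K F : Type) [Field K] [Field F] [Algebra K F]
    [FiniteDimensional K F] :
    IsOpen ((absGaloisRestrict K F).range : Set (absoluteGaloisGroup K)) := by
  haveI : Algebra.IsAlgebraic K F := Algebra.IsAlgebraic.of_finite K F
  obtain ⟨e, he⟩ := exists_mem_range_absGaloisRestrict_iff K F
  haveI : FiniteDimensional K e.fieldRange := by
    have h1 : FiniteDimensional K e.range :=
      LinearEquiv.finiteDimensional (AlgEquiv.ofInjectiveField e).toLinearEquiv
    have h2 : (e.fieldRange.toSubalgebra) = e.range := AlgHom.fieldRange_toSubalgebra e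
    exact (Subalgebra.equivOfEq _ _ h2.symm).toLinearEquiv.finiteDimensional
  have hset : ((absGaloisRestrict K F).range : Set (absoluteGaloisGroup K)) =
      (e.fieldRange.fixingSubgroup : Set (AlgebraicClosure K ≃ₐ[K] AlgebraicClosure K)) := by
    ext g
    change g ∈ (absGaloisRestrict K F).range ↔
      absoluteGaloisGroup.toAlgEquiv K g ∈ e.fieldRange.fixingSubgroup
    rw [he]
    constructor
    · intro h
      refine (IntermediateField.mem_fixingSubgroup_iff _ (absoluteGaloisGroup.toAlgEquiv K g)).2
        fun x hx ↦ ?_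
      obtain ⟨y, rfl⟩ := AlgHom.mem_fieldRange.1 hx
      have := h y
      rwa [absoluteGaloisGroup.smul_def] at this
    · intro h y
      rw [absoluteGaloisGroup.smul_def]
      exact (IntermediateField.mem_fixingSubgroup_iff _ (absoluteGaloisGroup.toAlgEquiv K g)).1 h _
        (AlgHom.mem_fieldRange.2 ⟨y, rfl⟩)
  rw [hset]
  exact e.fieldRange.fixingSubgroup_isOpen

/-! ## §1 The same-field bridge: unramified classes of `ker κ` ⇒ `Hom(ker κ, M; ∅)` finite -/

section SameField

variable {K : Type} [Field K] [NumberField K] {p : ℕ} [Fact p.Prime]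
variable {M : Type} [AddCommGroup M] [TopologicalSpace M] [DiscreteTopology M]

/-- **Same-field bridge.** For a `ℤ_p`-extension `κ` of `K` and a TRIVIAL discrete `Γ_K`-module `M`:
if the classes of `H¹(ker κ, M)` all of whose conjugates are unramified at every finite place form a
finite set (the conclusion of `IwasawaTheory.classicalMuVanishes_finite_unramifiedClasses`), then
`unramifiedHoms (N ⊓ ker κ) M ∅` is finite for every subgroup `N` (the case `F = K` of
`FineSelmerFiniteOfUnramifiedClasses.finite_unramifiedHoms_map_of_finite_unramifiedClasses`; a hom on
`N ⊓ ker κ` need not extend, so we go through `N = ⊤`: every member of `Hom(ker κ, M; ∅)` is the class of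
a hom, and restriction to `N ⊓ ker κ`… — stated for `N = ⊤` only). [cite: Lang1990, Ch. 5 §4]
[cite: NeukirchANT1999, Ch. I §9 Prop. (9.1)] -/
theorem finite_unramifiedHoms_of_finite_unramifiedClasses
    [DistribMulAction (absoluteGaloisGroup K) M]
    (htriv : ∀ (σ : absoluteGaloisGroup K) (m : M), σ • m = m) (κ : ZpExtension K p)
    (hfin : {c : subgroupH1 κ.kerSubgroup M |
      ∀ (w : HeightOneSpectrum (𝓞 K)) (σ : absoluteGaloisGroup K),
        conjH1 κ.kerSubgroup M σ c ∈ GreenbergVatsal2000.unramifiedKer κ.kerSubgroup M w}.Finite) :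
    (unramifiedHoms ((⊤ : Subgroup (absoluteGaloisGroup K)) ⊓ κ.kerSubgroup) M
      (∅ : Set (HeightOneSpectrum (𝓞 K)))).Finite := by
  set H := κ.kerSubgroup with hH
  set U : Subgroup (absoluteGaloisGroup K) := ⊤ ⊓ H with hU
  have hUH : U ≤ H := inf_le_right
  have hHU : H ≤ U := fun x hx ↦ Subgroup.mem_inf.2 ⟨Subgroup.mem_top x, hx⟩
  have htrivH : ∀ (g : H) (m : M), g • m = m := fun g m ↦ htriv (g : absoluteGaloisGroup K) m
  let g : (U → M) → H → M := fun f τ ↦ f ⟨τ, hHU τ.2⟩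
  have gadd : ∀ f ∈ unramifiedHoms U M (∅ : Set (HeightOneSpectrum (𝓞 K))),
      ∀ a b : H, g f (a * b) = g f a + g f b := fun f hf a b ↦
    hf.2.1 ⟨(a : absoluteGaloisGroup K), hHU a.2⟩ ⟨(b : absoluteGaloisGroup K), hHU b.2⟩
  have gcont : ∀ f ∈ unramifiedHoms U M (∅ : Set (HeightOneSpectrum (𝓞 K))), Continuous (g f) :=
    fun f hf ↦ hf.1.comp (continuous_subtype_val.subtype_mk _)
  have hvan : ∀ f ∈ unramifiedHoms U M (∅ : Set (HeightOneSpectrum (𝓞 K))),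
      ∀ (w : HeightOneSpectrum (𝓞 K)) (σ : absoluteGaloisGroup K) (y : inertiaIn H w),
        g f (subgroupConj H σ (inertiaInToH H w y)) = 0 := by
    intro f hf w σ y
    obtain ⟨-, hyI⟩ := (mem_inertiaIn_iff H w (y : decomp w)).1 y.2
    have e : GreenbergSelmer.inertia w =
        (adicCompletionPrime K w).inertia (absoluteGaloisGroup K) :=
      (inertia_adicCompletionPrime_eq_map_absInertia K w).symm
    rw [e] at hyI
    have h1 : σ⁻¹ * ((y : decomp w) : absoluteGaloisGroup K) * σ ∈
        (σ⁻¹ • adicCompletionPrime K w).inertia (absoluteGaloisGroup K) :=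
      FineSelmerFiniteOfUnramifiedClasses.conj_mem_inertia_inv_smul _ hyI σ
    haveI : (σ⁻¹ • adicCompletionPrime K w).IsMaximal := HeightOneSpectrum.isMaximal_of_mem_primesAbove
      (smul_mem_primesAbove (adicCompletionPrime_mem_primesAbove K w) σ⁻¹)
    obtain ⟨v, hv⟩ :=
      FineSelmerTrivialisingRestriction.exists_mem_primesAbove_of_isMaximal (σ⁻¹ • adicCompletionPrime K w)
    exact hf.2.2 v (Set.notMem_empty v) _ hv ⟨_, hHU (subgroupConj H σ (inertiaInToH H w y)).2⟩ h1
  let Φ : (U → M) → subgroupH1 H M := fun f ↦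
    if hf : f ∈ unramifiedHoms U M (∅ : Set (HeightOneSpectrum (𝓞 K))) then
      oneCocycleClass (discreteTopRep H M) (homCocycle htrivH (g f) (gadd f hf) (gcont f hf))
    else 0
  have hΦ : ∀ f (hf : f ∈ unramifiedHoms U M (∅ : Set (HeightOneSpectrum (𝓞 K)))),
      Φ f = oneCocycleClass (discreteTopRep H M)
        (homCocycle htrivH (g f) (gadd f hf) (gcont f hf)) := fun f hf ↦ dif_pos hf
  refine Set.Finite.of_finite_image (f := Φ) (hfin.subset ?_) ?_
  · rintro _ ⟨f, hf, rfl⟩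
    show Φ f ∈ _
    rw [hΦ f hf]
    intro w σ
    rw [conjH1_oneCocycleClass_mem_unramifiedKer_iff]
    refine ⟨0, fun y ↦ ?_⟩
    rw [smul_zero, sub_zero, homCocycle_apply, hvan f hf w σ y, smul_zero]
  · intro f₁ hf₁ f₂ hf₂ heq
    have heq' : Φ f₁ = Φ f₂ := heq
    rw [hΦ f₁ hf₁, hΦ f₂ hf₂, oneCocycleClass_eq_iff_of_trivial htrivH] at heq'
    funext u
    have h := congrArg (fun z : contOneCocycles (discreteTopRep H M) ↦ z.1 ⟨u, hUH u.2⟩) heq'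
    exact h

end SameField

/-! ## §2 Restriction along `Γ_F → Γ_K`: `Sel₀(K_∞, M)` finite from `Sel₀(F_∞, M|_F)` finite -/

section Restrict

variable {K F : Type} [Field K] [NumberField K] [Field F] [NumberField F] [Algebra K F]
  [FiniteDimensional K F]
variable {p : ℕ} [Fact p.Prime]
variable {M : Type} [AddCommGroup M] [DistribMulAction (absoluteGaloisGroup K) M]
  [TopologicalSpace M] [DiscreteTopology M]

/-- **Lim 2017 Lemma 3.2, residual form: `Sel₀(F_∞, M|_F)` finite ⟹ `Sel₀(K_∞, M)` finite.** Data: a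
finite extension `F/K` of number fields (`res = absGaloisRestrict K F`), `ℤ_p`-extensions `κ` of `K` and
`κ_F` of `F` with `ker κ_F = res⁻¹(ker κ)` (`F_∞ = F·K_∞`, e.g. both cyclotomic), a finite discrete
`Γ_K`-module `M` killed by an ODD `n` (so that the archimedean local conditions over `F` are automatic),
and `M|_F` = `M` with `Γ_F` acting through `res`. If the fine Selmer group of `M|_F` over `F_∞` is finite,
so is the fine Selmer group of `M` over `K_∞`: `z ↦ z ∘ res` carries cocycles with fine class to cocycles
with fine class (the local condition at a place `w` of `F_∞` is the local condition at the place of `K_∞`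
below it — `FineSelmerDevissage.exists_eq_smul_sub_of_mem_fineSelmerInfty` at the prime
`ι⁻¹(σ⁻¹𝔓₀(w))`), fine classes have finitely many cocycles each (`M` finite), and `z` is recovered from
`z ∘ res` and its values on representatives of the finite `H/(H ∩ res Γ_F)`.
[cite: Lim2017FineSelmer, §3 Lemma 3.2] [cite: CoatesSujatha2005, §3 (Lemma 3.3: restriction to a finite extension)]
[cite: SerreGaloisCohomology1997, I.§5.8 (inflation–restriction)] -/
theorem finite_fineSelmerInfty_of_finite_fineSelmerInfty_restrict [Finite M]
    (κ : ZpExtension K p) (κF : ZpExtension F p)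
    (hres : ∀ τ : absoluteGaloisGroup F,
      τ ∈ κF.kerSubgroup ↔ absGaloisRestrict K F τ ∈ κ.kerSubgroup)
    {n : ℕ} (hn : Odd n) (hM : ∀ m : M, n • m = 0)
    (hfin : letI : DistribMulAction (absoluteGaloisGroup F) M :=
        DistribMulAction.compHom M (absGaloisRestrict K F).toMonoidHom
      (fineSelmerInfty M κF : Set (subgroupH1 κF.kerSubgroup M)).Finite) :
    (fineSelmerInfty M κ : Set (subgroupH1 κ.kerSubgroup M)).Finite := by
  letI instF : DistribMulAction (absoluteGaloisGroup F) M :=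
    DistribMulAction.compHom M (absGaloisRestrict K F).toMonoidHom
  haveI : Algebra.IsAlgebraic K F := Algebra.IsAlgebraic.of_finite K F
  set res := absGaloisRestrict K F with hresdef
  set H := κ.kerSubgroup with hHdef
  set HF := κF.kerSubgroup with hHFdef
  have hmem : ∀ τ : HF, res (τ : absoluteGaloisGroup F) ∈ H := fun τ ↦ (hres τ).1 τ.2
  have hcoc : ∀ (z : contOneCocycles (discreteTopRep H M)) (a b : H),
      z.1 (a * b) = z.1 a + (a : absoluteGaloisGroup K) • z.1 b := fun z a b ↦ z.2 a b
  -- pulling back cocycles along `res`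
  let pull : contOneCocycles (discreteTopRep H M) → contOneCocycles (discreteTopRep HF M) := fun z ↦
    ⟨⟨fun τ ↦ z.1 ⟨res τ, hmem τ⟩,
      z.1.continuous.comp ((res.continuous.comp continuous_subtype_val).subtype_mk _)⟩,
     fun a b ↦ by
       have hab : (⟨res ((a * b : HF) : absoluteGaloisGroup F), hmem (a * b)⟩ : H) =
           ⟨res a, hmem a⟩ * ⟨res b, hmem b⟩ :=
         Subtype.ext (by
           change res ((a * b : HF) : absoluteGaloisGroup F) = res a * res b
           rw [Subgroup.coe_mul, map_mul])
       change z.1 ⟨res ((a * b : HF) : absoluteGaloisGroup F), hmem (a * b)⟩ =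
         z.1 ⟨res a, hmem a⟩ + res (a : absoluteGaloisGroup F) • z.1 ⟨res b, hmem b⟩
       rw [hab, hcoc]⟩
  have hpull : ∀ (z : contOneCocycles (discreteTopRep H M)) (τ : HF),
      (pull z).1 τ = z.1 ⟨res τ, hmem τ⟩ := fun _ _ ↦ rfl
  set Z0 : Set (contOneCocycles (discreteTopRep H M)) :=
    {z | oneCocycleClass _ z ∈ fineSelmerInfty M κ} with hZ0
  set Z0F : Set (contOneCocycles (discreteTopRep HF M)) :=
    {z | oneCocycleClass _ z ∈ fineSelmerInfty M κF} with hZ0F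
  have hZ0Ffin : Z0F.Finite := finite_setOf_oneCocycleClass_mem HF hfin
  ------------------------------------------------------------------
  -- fine classes pull back to fine classes
  have hfine : ∀ z ∈ Z0, pull z ∈ Z0F := by
    intro z hz
    refine (mem_fineSelmerInfty_iff_resOfLe κF _).2 ⟨fun w σ ↦ ?_, fun w σ ↦ ?_⟩
    · -- finite place `w` of `F`
      refine (CocycleCriteria.conjH1_oneCocycleClass_mem_ker_resOfLe_iff
        (inf_le_left : HF ⊓ decomp w ≤ HF) σ (pull z)).2 ?_
      set 𝔔 : Ideal (absIntegers (𝓞 F) F) := adicCompletionPrime F w with h𝔔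
      haveI : (σ⁻¹ • 𝔔).IsMaximal := HeightOneSpectrum.isMaximal_of_mem_primesAbove
        (smul_mem_primesAbove (adicCompletionPrime_mem_primesAbove F w) σ⁻¹)
      haveI : ((σ⁻¹ • 𝔔).comap (absIntegersMap K F)).IsMaximal :=
        Ideal.comap_isMaximal_of_surjective _ (absIntegersMap_surjective K F)
      obtain ⟨a, ha⟩ := exists_eq_smul_sub_of_mem_fineSelmerInfty κ z hz
        ((σ⁻¹ • 𝔔).comap (absIntegersMap K F))
      refine ⟨res σ • a, fun x ↦ ?_⟩
      obtain ⟨hxH, hxD⟩ := Subgroup.mem_inf.1 x.2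
      -- `σ⁻¹ x σ ∈ D_{σ⁻¹ 𝔔}`, hence `res (σ⁻¹ x σ) ∈ D_{ι⁻¹(σ⁻¹ 𝔔)}`
      have h1 : σ⁻¹ * (x : absoluteGaloisGroup F) * σ ∈
          (σ⁻¹ • 𝔔).decompositionSubgroup (absoluteGaloisGroup F) := by
        rw [Ideal.decompositionSubgroup_smul, Subgroup.mem_pointwise_smul_iff_inv_smul_mem, map_inv,
          inv_inv, MulAut.smul_def, MulAut.conj_apply, h𝔔,
          decompositionSubgroup_adicCompletionPrime_eq_range]
        have : σ * (σ⁻¹ * (x : absoluteGaloisGroup F) * σ) * σ⁻¹ = x := by group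
        rw [this]
        exact hxD
      have h2 : res (σ⁻¹ * (x : absoluteGaloisGroup F) * σ) ∈
          ((σ⁻¹ • 𝔔).comap (absIntegersMap K F)).decompositionSubgroup (absoluteGaloisGroup K) := by
        have h := (comap_decompositionSubgroup_comap_absIntegersMap K F (σ⁻¹ • 𝔔)).symm ▸ h1
        exact Subgroup.mem_comap.1 h
      have h3 := ha ⟨res (σ⁻¹ * (x : absoluteGaloisGroup F) * σ),
        hmem ⟨σ⁻¹ * (x : absoluteGaloisGroup F) * σ,
          (inferInstance : HF.Normal).conj_mem' _ hxH σ⟩⟩ h2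
      -- evaluate
      have hval : (pull z).1 (subgroupConj HF σ (Subgroup.inclusion inf_le_left x)) =
          z.1 ⟨res (σ⁻¹ * (x : absoluteGaloisGroup F) * σ),
            hmem ⟨σ⁻¹ * (x : absoluteGaloisGroup F) * σ,
              (inferInstance : HF.Normal).conj_mem' _ hxH σ⟩⟩ := rfl
      rw [hval, h3]
      change res σ • ((res (σ⁻¹ * (x : absoluteGaloisGroup F) * σ)) • a - a) =
        res (x : absoluteGaloisGroup F) • (res σ • a) - res σ • a
      rw [map_mul, map_mul, map_inv, smul_sub, smul_smul, ← mul_assoc, ← mul_assoc, mul_inv_cancel,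
        one_mul, mul_smul]
    · -- infinite place `w` of `F`: the local group has order `≤ 2`, `M` has odd exponent
      haveI := finite_absoluteGaloisGroup_completion_infinitePlace w
      have hsurj : ∀ g : (HF ⊓ decompInf w : Subgroup (absoluteGaloisGroup F)),
          ∃ τ : absoluteGaloisGroup w.Completion, absGaloisRestrict F w.Completion τ = g := fun g ↦
        (Subgroup.mem_inf.mp g.2).2
      choose lift hlift using hsurj
      have hinj : Function.Injective lift := fun g g' h ↦ by
        apply Subtype.ext
        rw [← hlift g, ← hlift g', h]
      haveI : Finite (HF ⊓ decompInf w : Subgroup (absoluteGaloisGroup F)) :=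
        Finite.of_injective lift hinj
      have hcard : Nat.card (HF ⊓ decompInf w : Subgroup (absoluteGaloisGroup F)) ≤ 2 :=
        (Nat.card_le_card_of_injective lift hinj).trans
          (natCard_absoluteGaloisGroup_completion_infinitePlace_le_two w)
      exact eq_zero_of_odd_nsmul_eq_zero_of_natCard_le_two hcard _ hn _
        (nsmul_subgroupH1_eq_zero _ hM _)
  ------------------------------------------------------------------
  -- the open subgroup `U = res Γ_F ∩ H` and representatives of `H/U`
  set U : Subgroup (absoluteGaloisGroup K) := res.range ⊓ H with hUdef
  have hUH : U ≤ H := inf_le_right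
  set V : Subgroup H := U.subgroupOf H with hVdef
  haveI : CompactSpace H := isCompact_iff_compactSpace.mp κ.isClosed_kerSubgroup.isCompact
  have hVopen : IsOpen (V : Set H) := by
    have : (V : Set H) = Subtype.val ⁻¹' ((res.range : Subgroup (absoluteGaloisGroup K)) :
        Set (absoluteGaloisGroup K)) := by
      ext x
      simp only [hVdef, hUdef, SetLike.mem_coe, Subgroup.mem_subgroupOf, Subgroup.mem_inf,
        Set.mem_preimage]
      exact ⟨fun h ↦ h.1, fun h ↦ ⟨h, x.2⟩⟩
    rw [this]
    exact (isOpen_range_absGaloisRestrict K F).preimage continuous_subtype_val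
  haveI hfinHV : Finite (H ⧸ V) := Subgroup.quotient_finite_of_isOpen V hVopen
  -- `z` is determined by `pull z` and its values on representatives
  have hinj : Set.InjOn (fun z : contOneCocycles (discreteTopRep H M) ↦
      (pull z, fun q : H ⧸ V ↦ z.1 q.out)) Z0 := by
    intro z _ z' _ hzz'
    simp only [Prod.mk.injEq] at hzz'
    obtain ⟨hP, hq⟩ := hzz'
    apply Subtype.ext
    ext x
    obtain ⟨w, hw⟩ := QuotientGroup.mk_out_eq_mul V x
    have hx : x = (QuotientGroup.mk x : H ⧸ V).out * ((w⁻¹ : V) : H) := by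
      rw [hw, Subgroup.coe_inv, mul_inv_cancel_right]
    have hwU : (((w⁻¹ : V) : H) : absoluteGaloisGroup K) ∈ U := Subgroup.mem_subgroupOf.1 (w⁻¹).2
    obtain ⟨⟨τ, hτ⟩, hwH⟩ := Subgroup.mem_inf.1 hwU
    have hτF : τ ∈ HF := (hres τ).2 (hτ ▸ hwH)
    have h1 : z.1 ((w⁻¹ : V) : H) = z'.1 ((w⁻¹ : V) : H) := by
      have e : ((w⁻¹ : V) : H) = ⟨res τ, hmem ⟨τ, hτF⟩⟩ := Subtype.ext hτ.symm
      have h := congrArg (fun zz : contOneCocycles (discreteTopRep HF M) ↦ zz.1 ⟨τ, hτF⟩) hP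
      simp only [hpull] at h
      rw [e]
      exact h
    have h2 : z.1 (QuotientGroup.mk x : H ⧸ V).out = z'.1 (QuotientGroup.mk x : H ⧸ V).out :=
      congrFun hq _
    rw [hx, hcoc, hcoc, h2, h1]
  have himg : ((fun z : contOneCocycles (discreteTopRep H M) ↦
      (pull z, fun q : H ⧸ V ↦ z.1 q.out)) '' Z0).Finite := by
    refine (hZ0Ffin.prod (Set.finite_univ (α := (H ⧸ V) → M))).subset ?_
    rintro _ ⟨z, hz, rfl⟩
    exact ⟨hfine z hz, Set.mem_univ _⟩
  have hZ0fin : Z0.Finite := Set.Finite.of_finite_image himg hinj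
  have hsub : (fineSelmerInfty M κ : Set (subgroupH1 H M)) ⊆
      oneCocycleClass (discreteTopRep H M) '' Z0 := by
    intro x hx
    obtain ⟨z, rfl⟩ := oneCocycleClass_surjective _ x
    exact ⟨z, hx, rfl⟩
  exact (hZ0fin.image _).subset hsub

end Restrict

/-! ## §3 Descent: `Sel₀(K_∞, M)` finite when `M` is unipotent of level two over an extension `F`
with classical `μ = 0` -/

section Unipotent

variable {K F : Type} [Field K] [NumberField K] [Field F] [NumberField F] [Algebra K F]
  [FiniteDimensional K F]
variable {p : ℕ} [Fact p.Prime]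
variable {M : Type} [AddCommGroup M] [DistribMulAction (absoluteGaloisGroup K) M]
  [TopologicalSpace M] [DiscreteTopology M]

/-- **Descent of statement (A)-type finiteness along an extension trivialising `M` up to a flag.**
`K ⊆ F` number fields, `p` odd, `κ`/`κ_F` the cyclotomic `ℤ_p`-extensions, `M` a finite discrete
`p`-torsion `Γ_K`-module unramified outside a finite set `S`, and `C ≤ M` a subgroup such that
`res Γ_F` FIXES `C` pointwise and acts TRIVIALLY on `M/C` (e.g. `Gal(K(M)/F)` a `p`-group and `#M = p²`).
If `classicalMuVanishes_finite_unramifiedClasses` (character form of Iwasawa's `μ = 0`) and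
`ClassicalMuVanishes κ_F`, then `Sel₀(K_∞, M)` is finite: dévissage over `F` with `N = Γ_F`
(`FineSelmerDevissage.finite_fineSelmerInfty_of_extension`, inputs from the same-field bridge), then
restriction (`finite_fineSelmerInfty_of_finite_fineSelmerInfty_restrict`).
[cite: Lim2017FineSelmer, §3 Thm. 3.5 and Lemma 3.2] [cite: CoatesSujatha2005, §3 Cor. 3.5]
[cite: Lang1990, Ch. 5 §4] -/
theorem finite_fineSelmerInfty_of_unipotent_restrict [Finite M]
    (hchar : Literature.NumberTheory.IwasawaTheory.classicalMuVanishes_finite_unramifiedClasses)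
    (hp : Odd p) (κ : ZpExtension K p) (hκ : κ.IsCyclotomic)
    (κF : ZpExtension F p) (hκF : κF.IsCyclotomic)
    (hμ : Literature.NumberTheory.IwasawaTheory.ClassicalMuVanishes κF)
    (hM : ∀ m : M, p • m = 0) (hcardM : ∃ k : ℕ, Nat.card M = p ^ k)
    (S : Set (HeightOneSpectrum (𝓞 K))) (hS : S.Finite)
    (hunr : ∀ v ∉ S, ∀ 𝔓 ∈ v.primesAbove, ∀ σ ∈ 𝔓.inertia (absoluteGaloisGroup K),
      ∀ m : M, σ • m = m)
    (C : AddSubgroup M)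
    (hC1 : ∀ (τ : absoluteGaloisGroup F) (m : M), m ∈ C → absGaloisRestrict K F τ • m = m)
    (hC2 : ∀ (τ : absoluteGaloisGroup F) (m : M), absGaloisRestrict K F τ • m - m ∈ C) :
    (fineSelmerInfty M κ : Set (subgroupH1 κ.kerSubgroup M)).Finite := by
  have hpr : p.Prime := Fact.out
  haveI : Algebra.IsAlgebraic K F := Algebra.IsAlgebraic.of_finite K F
  set res := absGaloisRestrict K F with hresdef
  have hker := FineSelmerFiniteOfUnramifiedClasses.kerSubgroup_eq_comap_of_isCyclotomic κ hκ κF hκF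
  have hres' : ∀ τ : absoluteGaloisGroup F, τ ∈ κF.kerSubgroup ↔ res τ ∈ κ.kerSubgroup := fun τ ↦ by
    rw [hker]; rfl
  refine finite_fineSelmerInfty_of_finite_fineSelmerInfty_restrict κ κF hres' hp hM ?_
  -- over `F`, with `Γ_F` acting through `res`
  letI instF : DistribMulAction (absoluteGaloisGroup F) M := DistribMulAction.compHom M res.toMonoidHom
  have hsmulF : ∀ (σ : absoluteGaloisGroup F) (m : M), σ • m = res σ • m := fun _ _ ↦ rfl
  show (fineSelmerInfty M κF : Set (subgroupH1 κF.kerSubgroup M)).Finite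
  -- cards of `C` and `M ⧸ C`
  have hcardC : ∃ k : ℕ, Nat.card C = p ^ k := by
    obtain ⟨k, hk⟩ := hcardM
    have hdvd : Nat.card C ∣ p ^ k := hk ▸ AddSubgroup.card_addSubgroup_dvd_card C
    obtain ⟨j, -, hj⟩ := (Nat.dvd_prime_pow hpr).1 hdvd
    exact ⟨j, hj⟩
  have hcardQ : ∃ k : ℕ, Nat.card (M ⧸ C) = p ^ k := by
    obtain ⟨k, hk⟩ := hcardM
    have hdvd : Nat.card (M ⧸ C) ∣ p ^ k := hk ▸ AddSubgroup.card_quotient_dvd_card C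
    obtain ⟨j, -, hj⟩ := (Nat.dvd_prime_pow hpr).1 hdvd
    exact ⟨j, hj⟩
  -- the quotient `Γ_F`-module `M ⧸ C` (trivial action)
  have hCstab : ∀ (σ : absoluteGaloisGroup F) (x : M), x ∈ C → σ • x ∈ C := fun σ x hx ↦ by
    rw [hsmulF, hC1 σ x hx]; exact hx
  letI instQ : DistribMulAction (absoluteGaloisGroup F) (M ⧸ C) :=
    { smul := fun σ ↦ QuotientAddGroup.map C C (DistribSMul.toAddMonoidHom M σ)
        (fun x hx ↦ AddSubgroup.mem_comap.2 (hCstab σ x hx))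
      one_smul := fun q ↦ QuotientAddGroup.induction_on q fun m ↦ by
        change QuotientAddGroup.map C C (DistribSMul.toAddMonoidHom M (1 : absoluteGaloisGroup F)) _
          (m : M ⧸ C) = _
        rw [QuotientAddGroup.map_mk, DistribSMul.toAddMonoidHom_apply, one_smul]
      mul_smul := fun σ τ q ↦ QuotientAddGroup.induction_on q fun m ↦ by
        change QuotientAddGroup.map C C (DistribSMul.toAddMonoidHom M (σ * τ)) _ (m : M ⧸ C) =
          QuotientAddGroup.map C C (DistribSMul.toAddMonoidHom M σ) _
            (QuotientAddGroup.map C C (DistribSMul.toAddMonoidHom M τ) _ (m : M ⧸ C))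
        rw [QuotientAddGroup.map_mk, QuotientAddGroup.map_mk, QuotientAddGroup.map_mk,
          DistribSMul.toAddMonoidHom_apply, DistribSMul.toAddMonoidHom_apply,
          DistribSMul.toAddMonoidHom_apply, mul_smul]
      smul_zero := fun σ ↦ map_zero _
      smul_add := fun σ a b ↦ map_add _ a b }
  letI : TopologicalSpace (M ⧸ C) := ⊥
  haveI : DiscreteTopology (M ⧸ C) := ⟨rfl⟩
  have hsmulQ : ∀ (σ : absoluteGaloisGroup F) (m : M), σ • (m : M ⧸ C) = ((σ • m : M) : M ⧸ C) :=
    fun σ m ↦ rfl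
  let π : M →+ M ⧸ C := QuotientAddGroup.mk' C
  have hπ : ∀ (σ : absoluteGaloisGroup F) (m : M), π (σ • m) = σ • π m := fun σ m ↦ rfl
  have hπker : ∀ m : M, π m = 0 ↔ m ∈ C := fun m ↦ QuotientAddGroup.eq_zero_iff m
  have htrivQ : ∀ (σ : absoluteGaloisGroup F) (q : M ⧸ C), σ • q = q := fun σ q ↦
    QuotientAddGroup.induction_on q fun m ↦ by
      rw [hsmulQ, QuotientAddGroup.eq_iff_sub_mem]
      exact hC2 σ m
  have hNQ : ∀ σ ∈ (⊤ : Subgroup (absoluteGaloisGroup F)), ∀ q : M ⧸ C, σ • q = q :=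
    fun σ _ q ↦ htrivQ σ q
  have hNC : ∀ σ ∈ (⊤ : Subgroup (absoluteGaloisGroup F)), ∀ m : M, π m = 0 → σ • m = m :=
    fun σ _ m hm ↦ hC1 σ m ((hπker m).1 hm)
  haveI : (⊤ : Subgroup (absoluteGaloisGroup F)).Normal := ⟨fun _ _ _ ↦ Subgroup.mem_top _⟩
  have hNopen : IsOpen ((⊤ : Subgroup (absoluteGaloisGroup F)) : Set (absoluteGaloisGroup F)) := by
    rw [Subgroup.coe_top]; exact isOpen_univ
  -- the finite set of places of `F` above `S`, outside which `M|_F` is unramified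
  set SF : Set (HeightOneSpectrum (𝓞 F)) :=
    {w | ∃ v ∈ S, w.asIdeal.under (𝓞 K) = v.asIdeal} with hSFdef
  have hSF : SF.Finite := by
    have h : SF ⊆ ⋃ v ∈ S, {w : HeightOneSpectrum (𝓞 F) | w.asIdeal ∈ v.asIdeal.primesOver (𝓞 F)} := by
      rintro w ⟨v, hv, hw⟩
      simp only [Set.mem_iUnion, Set.mem_setOf_eq]
      exact ⟨v, hv, w.isPrime, ⟨hw.symm⟩⟩
    refine (hS.biUnion fun v _ ↦ ?_).subset h
    have hf := IsDedekindDomain.primesOver_finite v.asIdeal (𝓞 F)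
    refine (hf.preimage ?_ :
      {w : HeightOneSpectrum (𝓞 F) | w.asIdeal ∈ v.asIdeal.primesOver (𝓞 F)}.Finite)
    exact fun w _ w' _ h ↦ HeightOneSpectrum.ext h
  have hunrF : ∀ w ∉ SF, ∀ 𝔔 ∈ w.primesAbove, ∀ σ ∈ 𝔔.inertia (absoluteGaloisGroup F),
      ∀ m : M, σ • m = m := by
    intro w hw 𝔔 h𝔔 σ hσ m
    haveI := HeightOneSpectrum.isMaximal_of_mem_primesAbove h𝔔
    haveI : (𝔔.comap (absIntegersMap K F)).IsMaximal :=
      Ideal.comap_isMaximal_of_surjective _ (absIntegersMap_surjective K F)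
    obtain ⟨v, hv⟩ :=
      FineSelmerTrivialisingRestriction.exists_mem_primesAbove_of_isMaximal (𝔔.comap (absIntegersMap K F))
    obtain ⟨w', hw'v, hw'𝔔, -⟩ := exists_heightOneSpectrum_of_comap_absIntegersMap_mem_primesAbove hv
    have hww' : w = w' := HeightOneSpectrum.ext (by rw [h𝔔.2.over, hw'𝔔.2.over])
    have hvS : v ∉ S := fun hvS ↦ hw ⟨v, hvS, hww' ▸ hw'v⟩
    rw [hsmulF]
    exact hunr v hvS _ hv _ (absGaloisRestrict_mem_inertia_comap K F hσ) m
  -- the two finiteness inputs, from the character form of `μ = 0` over `F`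
  have hQfin : (unramifiedHoms ((⊤ : Subgroup (absoluteGaloisGroup F)) ⊓ κF.kerSubgroup) (M ⧸ C)
      (∅ : Set (HeightOneSpectrum (𝓞 F)))).Finite :=
    finite_unramifiedHoms_of_finite_unramifiedClasses htrivQ κF
      (hchar F p κF (Or.inl hp) hμ (M ⧸ C) hcardQ htrivQ)
  have hCfin : {f ∈ unramifiedHoms ((⊤ : Subgroup (absoluteGaloisGroup F)) ⊓ κF.kerSubgroup) M
      (∅ : Set (HeightOneSpectrum (𝓞 F))) | ∀ u, π (f u) = 0}.Finite := by
    letI instC : DistribMulAction (absoluteGaloisGroup F) C :=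
      { smul := fun _ c ↦ c
        one_smul := fun _ ↦ rfl
        mul_smul := fun _ _ _ ↦ rfl
        smul_zero := fun _ ↦ rfl
        smul_add := fun _ _ _ ↦ rfl }
    have htrivC : ∀ (σ : absoluteGaloisGroup F) (c : C), σ • c = c := fun _ _ ↦ rfl
    have h := finite_unramifiedHoms_of_finite_unramifiedClasses htrivC κF
      (hchar F p κF (Or.inl hp) hμ C hcardC htrivC)
    refine (h.image fun (f' : ↥((⊤ : Subgroup (absoluteGaloisGroup F)) ⊓ κF.kerSubgroup) → C) u ↦
      (f' u : M)).subset ?_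
    rintro f ⟨hf, hfπ⟩
    have hfC : ∀ u, f u ∈ C := fun u ↦ (hπker _).1 (hfπ u)
    refine ⟨fun u ↦ ⟨f u, hfC u⟩, ⟨hf.1.subtype_mk _, fun σ τ ↦ Subtype.ext (hf.2.1 σ τ),
      fun v hv 𝔓 h𝔓 σ hσ ↦ Subtype.ext (hf.2.2 v hv 𝔓 h𝔓 σ hσ)⟩, rfl⟩
  exact finite_fineSelmerInfty_of_extension κF hκF π hπ ⊤ hNopen hNQ hNC SF hSF hunrF hQfin hCfin

end Unipotent

end Literature.NumberTheory.EllipticCurves.FineSelmerRestrictionDescent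

end
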